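import Summits.AtomisticToContinuum.Crystallization.Theorems.ChartedZeroExcessLayeredLatticeLiouvilleZZZYRCX

/-!
# Charted zero-excess layered-lattice Liouville — ZZZYRCY: the REGISTRY FLOOR LEMMA, the middle placement `hgeo`, the THREE-WAY BOX READER

Cell `decomp-a2c`, lens 2, generation 100 (critic r1843 three-way cover, r1851 (B)).  On the objects of ZZZYRCX:

§1 ★ REGISTRY FLOOR / CEILING: for a word with letters in `{0,1,2}` and ANY pair `x`,
   `xiFloor (x.2 − x.1) ≤ n9W wd x ≤ xiCeil (x.2 − x.1)` (ZZZYRCVL §5) — the registry-letter difference `d` of the two layers is one of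
   the five offsets `|d| ≤ 2` of `xiQmn / xiQmx` (ZZZYRCVK), and `d = 0` on equal layers (`xiQ0`); `0 < n9W ⇒ x.2 ≠ x.1`.
§2 ★★ THE MIDDLE PLACEMENT `middle_hgeo`: the length comparison `IdealLengthCmp wd λ μ` of a box word, `(HI1 : ℤ) ≤ hi` and the dial
   inequality `9·D² ≤ λ²·HI2` give, for every pair of the MIDDLE class `¬ IdealNear wd hi x ∧ ‖e_x‖ ≤ D`:
   `xiMember HI1 HI2 (x.2 − x.1) ∧ λ²·xiFloor (x.2 − x.1) ≤ 9‖e_x‖²` — LITERALLY the hypothesis `hgeo` of `schemeDominatedOnP_middle`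
   (ZZZYRCVP, GO (333)) at `P := fun x => ¬ IdealNear wd hi x ∧ ‖e_x‖ ≤ D`, i.e. the instantiation of `schemeDominatedOnP_king_table`
   (ZZZYRCV (322)) with `F := xiFloor`, `M := xiMset HI1 HI2 Gb Mm`; of record `hi = HI1 = 5184 = 9·24²`, `D = 64`,
   `HI2 = ⌈9·64²/λ_min²⌉` (census R3 envelope).
§3 the splice at the IDEAL cut (`idealSpliceN / idealSpliceZ`: data paths on `IdealNear wd hi`, a second system beyond) and the cover
   lemmas NEAR (class `IdealNear wd hi`) + MIDDLE (class `¬ IdealNear wd hi ∧ S`) ⇒ class `S` with the summed tables.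
§4 ★★ THE THREE-WAY BOX READER `boxSchemeP_of_cover3`: `BoxSchemeP s Λ c₀ ℓ₀ ϱ α B …` with tables `Θ¹ + Θ² + (1+α^{±1})θ` from
   (near) the reader contract's conclusion per admissible word of the box — `IsPathSystemOn`/`SchemeDominatedOnP` on `IdealNear wd hi`;
   (middle) king-table domination on `¬ IdealNear wd hi ∧ ‖e‖ ≤ D` per word (its king path system comes from `isPathSystem_king`);
   (box) `‖gen₁ L‖ + ‖gen₂ L‖ + ℓ₀ ≤ ϱ`; (far-far) the ONE numeric inequality of `schemeDominatedOnP_remainder_king_far` (ZZZYRCR) at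
   `(D, c₀, ϱ, nD, n₁, θ)` — at `(64, 37/50, 4)`: `nD = 17`, `n₁ = 87`, `θ = 1/10000` (value `8.82·10⁻⁵`, bc/RCR_inst64.lean).
   It is `boxSchemeP_of_split` (ZZZYRCT) with its near class `‖e‖ ≤ D` covered by NEAR ∪ MIDDLE; downstream unchanged
   (`boxTailDebitP_of_scheme`, ZZZYRCH → `uniformEquilStabilityAt_of_atlas`).

WEAKER / ATTACKABLE: §1–§3 are proved lemmas about one word's integer geometry; §4 is pure logic over RCT/RCP/RCR.  What remains OPEN on
line (D) after this file: the near contract `ThetaReaderNear` (lens-2), hand-1's decode to `KernelSlabSound`, the Ξ slab K-files at the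
census `HI2`, the θ⁰ slab files, and the box comparison lemmas (`IdealLengthCmp` / `IdealAngleCmp` from the chart box).
Theorem file (2 defs `idealSpliceN` `idealSpliceZ`, 8 theorems); imports ZZZYRCX; no instance / notation / option; 0 sorry. [g100]
-/

namespace Summit.AtomisticToContinuum.Crystallization.Theorems.ChartedZeroExcessLayeredLatticeLiouville

open scoped BigOperators
open Summit.AtomisticToContinuum.Crystallization.Theorems.ChartedPlanarOrderRigidityDoor (E3)

/-! ### §1 the registry floor and ceiling of the ideal length -/

/-- `a² + ab + b² ≥ 0`. [g100] -/
theorem xiQhex_nonneg (a b : ℤ) : 0 ≤ xiQhex a b := by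
  unfold xiQhex; nlinarith [sq_nonneg (2 * a + b), sq_nonneg b]

/-- the offset term `qhex(3x + d, 3y + d)`, `|d| ≤ 2`, lies between the registry floor `xiQmn x y` and ceiling `xiQmx x y`. [g100] -/
theorem xiQmn_le_offset {d : ℤ} (hd : -2 ≤ d ∧ d ≤ 2) (x y : ℤ) :
    (xiQmn x y : ℤ) ≤ xiQhex (3 * x + d) (3 * y + d) ∧ xiQhex (3 * x + d) (3 * y + d) ≤ (xiQmx x y : ℤ) := by
  have h5 : xiQmn x y ≤ (xiQhex (3 * x + d) (3 * y + d)).toNat ∧ (xiQhex (3 * x + d) (3 * y + d)).toNat ≤ xiQmx x y := by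
    rcases (show d = 0 ∨ d = 1 ∨ d = -1 ∨ d = 2 ∨ d = -2 by omega) with rfl | rfl | rfl | rfl | rfl
    · simp only [add_zero, xiQmn, xiQmx, min_le_iff, le_max_iff, le_refl, true_or, and_self]
    · simp only [xiQmn, xiQmx, min_le_iff, le_max_iff, le_refl, true_or, or_true, and_self]
    · simp only [← sub_eq_add_neg, xiQmn, xiQmx, min_le_iff, le_max_iff, le_refl, true_or, or_true, and_self]
    · simp only [xiQmn, xiQmx, min_le_iff, le_max_iff, le_refl, true_or, or_true, and_self]
    · simp only [← sub_eq_add_neg, xiQmn, xiQmx, min_le_iff, le_max_iff, le_refl, or_true, and_self]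
  have key : ((xiQhex (3 * x + d) (3 * y + d)).toNat : ℤ) = xiQhex (3 * x + d) (3 * y + d) :=
    Int.toNat_of_nonneg (xiQhex_nonneg _ _)
  constructor
  · calc (xiQmn x y : ℤ) ≤ ((xiQhex (3 * x + d) (3 * y + d)).toNat : ℤ) := by exact_mod_cast h5.1
      _ = _ := key
  · calc xiQhex (3 * x + d) (3 * y + d) = ((xiQhex (3 * x + d) (3 * y + d)).toNat : ℤ) := key.symm
      _ ≤ _ := by exact_mod_cast h5.2

/-- ★ THE REGISTRY FLOOR LEMMA: for a word with letters in `{0,1,2}` the ideal `9|e_x|²` of ANY pair lies between the registry floor and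
the registry ceiling of its index difference (ZZZYRCVL §5). [g100] -/
theorem xiFloor_le_n9W {wd : List ℤ} (hwd : ∀ m : ℤ, 0 ≤ regW wd m ∧ regW wd m ≤ 2) (x : (Cell 2 × ℤ) × (Cell 2 × ℤ)) :
    ((xiFloor (x.2 - x.1) : ℕ) : ℤ) ≤ n9W wd x ∧ n9W wd x ≤ ((xiCeil (x.2 - x.1) : ℕ) : ℤ) := by
  have hd : -2 ≤ regW wd x.2.2 - regW wd x.1.2 ∧ regW wd x.2.2 - regW wd x.1.2 ≤ 2 := by
    obtain ⟨a1, a2⟩ := hwd x.2.2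
    obtain ⟨b1, b2⟩ := hwd x.1.2
    constructor <;> linarith
  have hX : (x.2 - x.1).1 0 = x.2.1 0 - x.1.1 0 := rfl
  have hY : (x.2 - x.1).1 1 = x.2.1 1 - x.1.1 1 := rfl
  have hM : (x.2 - x.1).2 = x.2.2 - x.1.2 := rfl
  have key : n9W wd x = xiQhex (3 * (x.2.1 0 - x.1.1 0) + (regW wd x.2.2 - regW wd x.1.2))
      (3 * (x.2.1 1 - x.1.1 1) + (regW wd x.2.2 - regW wd x.1.2)) + 6 * ((x.2.2 - x.1.2) * (x.2.2 - x.1.2)) := by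
    simp only [n9W, refW0, refW1, xiQhex]; ring
  by_cases hm : x.2.2 - x.1.2 = 0
  · have h12 : x.2.2 = x.1.2 := sub_eq_zero.mp hm
    have hq : n9W wd x = ((xiQ0 (x.2.1 0 - x.1.1 0) (x.2.1 1 - x.1.1 1) : ℕ) : ℤ) := by
      rw [key, xiQ0, Int.toNat_of_nonneg (xiQhex_nonneg _ _), hm, h12, sub_self, add_zero, add_zero, mul_zero, mul_zero, add_zero]
    have hF : xiFloor (x.2 - x.1) = xiQ0 (x.2.1 0 - x.1.1 0) (x.2.1 1 - x.1.1 1) := by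
      simp only [xiFloor, hM, hm, hX, hY, if_true]
    have hC : xiCeil (x.2 - x.1) = xiQ0 (x.2.1 0 - x.1.1 0) (x.2.1 1 - x.1.1 1) := by
      simp only [xiCeil, hM, hm, hX, hY, if_true]
    rw [hF, hC, ← hq]; exact ⟨le_rfl, le_rfl⟩
  · have hF : xiFloor (x.2 - x.1) =
        xiQmn (x.2.1 0 - x.1.1 0) (x.2.1 1 - x.1.1 1) + 6 * (x.2.2 - x.1.2).natAbs * (x.2.2 - x.1.2).natAbs := by
      simp only [xiFloor, hM, hm, hX, hY, if_false]
    have hC : xiCeil (x.2 - x.1) =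
        xiQmx (x.2.1 0 - x.1.1 0) (x.2.1 1 - x.1.1 1) + 6 * (x.2.2 - x.1.2).natAbs * (x.2.2 - x.1.2).natAbs := by
      simp only [xiCeil, hM, hm, hX, hY, if_false]
    have hsq : ((x.2.2 - x.1.2).natAbs : ℤ) * ((x.2.2 - x.1.2).natAbs : ℤ) = (x.2.2 - x.1.2) * (x.2.2 - x.1.2) :=
      Int.natAbs_mul_self' _
    obtain ⟨h1, h2⟩ := xiQmn_le_offset hd (x.2.1 0 - x.1.1 0) (x.2.1 1 - x.1.1 1)
    rw [hF, hC, key]; push_cast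
    constructor <;> nlinarith [h1, h2, hsq, abs_mul_abs_self (x.2.2 - x.1.2)]

/-- a pair of positive ideal length has a nonzero index difference. [g100] -/
theorem sub_ne_zero_of_n9W_pos {wd : List ℤ} {x : (Cell 2 × ℤ) × (Cell 2 × ℤ)} (h : 0 < n9W wd x) : x.2 - x.1 ≠ 0 := by
  intro h0
  have h12 : x.2 = x.1 := sub_eq_zero.mp h0
  have hz : n9W wd x = 0 := by simp only [n9W, h12, sub_self, mul_zero, add_zero, zero_pow two_ne_zero]
  rw [hz] at h; exact lt_irrefl _ h

/-! ### §2 the middle-class placement -/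

/-- ★★ **THE MIDDLE PLACEMENT `hgeo`**: for a `{0,1,2}`-word, the ideal length comparison `λ²·n9 ≤ 9‖e_x‖²`, `(HI1 : ℤ) ≤ hi` and the
dial inequality `9·D² ≤ λ²·HI2` place every far pair of the middle class `¬ IdealNear wd hi x ∧ ‖e_x‖ ≤ D` in the certified vector set:
`xiMember HI1 HI2 (x.2 − x.1)` and `λ²·xiFloor (x.2 − x.1) ≤ 9‖e_x‖²` (hypothesis `hgeo` of `schemeDominatedOnP_middle`, ZZZYRCVP;
with `F := xiFloor` the `hPM` of `schemeDominatedOnP_king_table`, ZZZYRCV). [g100] -/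
theorem middle_hgeo {wd : List ℤ} (hwd : ∀ m : ℤ, 0 ≤ regW wd m ∧ regW wd m ≤ 2) {hi : ℤ} {HI1 HI2 : ℕ} {ϱ lam mu D : ℝ}
    {a b : E3} {w : ℤ → E3} (hlam : 0 < lam) (hL : IdealLengthCmp wd lam mu a b w) (h1 : (HI1 : ℤ) ≤ hi)
    (h2 : 9 * D ^ 2 ≤ lam ^ 2 * (HI2 : ℝ)) :
    ∀ x : (Cell 2 × ℤ) × (Cell 2 × ℤ), ϱ < ‖bondVec a b w x‖ → (¬ IdealNear wd hi x ∧ ‖bondVec a b w x‖ ≤ D) →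
      xiMember HI1 HI2 (x.2 - x.1) ∧ lam ^ 2 * (xiFloor (x.2 - x.1) : ℝ) ≤ 9 * ‖bondVec a b w x‖ ^ 2 := by
  intro x _ hP
  obtain ⟨hN, hD⟩ := hP
  rw [idealNear_iff, not_le] at hN
  obtain ⟨hfl, hce⟩ := xiFloor_le_n9W hwd x
  have hpos : 0 < n9W wd x := lt_of_le_of_lt (by positivity) (h1.trans_lt hN)
  have hc : HI1 < xiCeil (x.2 - x.1) := by exact_mod_cast h1.trans_lt (hN.trans_le hce)
  have hflR : ((xiFloor (x.2 - x.1) : ℕ) : ℝ) ≤ (n9W wd x : ℝ) := by exact_mod_cast hfl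
  have hle : lam ^ 2 * (xiFloor (x.2 - x.1) : ℝ) ≤ 9 * ‖bondVec a b w x‖ ^ 2 :=
    (mul_le_mul_of_nonneg_left hflR (sq_nonneg lam)).trans (hL x).1
  have hD2 : ‖bondVec a b w x‖ ^ 2 ≤ D ^ 2 := pow_le_pow_left₀ (norm_nonneg _) hD 2
  have hf2R : (xiFloor (x.2 - x.1) : ℝ) ≤ (HI2 : ℝ) := le_of_mul_le_mul_left (by linarith) (pow_pos hlam 2)
  have hf2 : xiFloor (x.2 - x.1) ≤ HI2 := by exact_mod_cast hf2R
  exact ⟨⟨hc, hf2, sub_ne_zero_of_n9W_pos hpos⟩, hle⟩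

/-! ### §3 the splice at the ideal cut and the near ∪ middle cover -/

/-- spliced piece counts at the IDEAL cut `hi`: `np₁` on `IdealNear wd hi`, `np₂` beyond. [g100] -/
def idealSpliceN (wd : List ℤ) (hi : ℤ) (np₁ np₂ : (Cell 2 × ℤ) × (Cell 2 × ℤ) → ℕ) (x : (Cell 2 × ℤ) × (Cell 2 × ℤ)) : ℕ :=
  if n9W wd (toBase wd.length x) ≤ hi then np₁ x else np₂ x

/-- spliced node sequences at the IDEAL cut `hi`. [g100] -/
def idealSpliceZ (wd : List ℤ) (hi : ℤ) (z₁ z₂ : (Cell 2 × ℤ) × (Cell 2 × ℤ) → ℕ → Cell 2 × ℤ)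
    (x : (Cell 2 × ℤ) × (Cell 2 × ℤ)) : ℕ → Cell 2 × ℤ :=
  if n9W wd (toBase wd.length x) ≤ hi then z₁ x else z₂ x

/-- ★ NEAR ∪ MIDDLE path systems: a system on `IdealNear wd hi` and one on `¬ IdealNear wd hi ∧ S` splice to one on `S`. [g100] -/
theorem isPathSystemOn_idealCover {ϱ : ℝ} {a b : E3} {w : ℤ → E3} {wd : List ℤ} {hi : ℤ}
    {S : (Cell 2 × ℤ) × (Cell 2 × ℤ) → Prop} {np₁ np₂ : (Cell 2 × ℤ) × (Cell 2 × ℤ) → ℕ}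
    {z₁ z₂ : (Cell 2 × ℤ) × (Cell 2 × ℤ) → ℕ → Cell 2 × ℤ} (h₁ : IsPathSystemOn ϱ a b w (IdealNear wd hi) np₁ z₁)
    (h₂ : IsPathSystemOn ϱ a b w (fun x => ¬ IdealNear wd hi x ∧ S x) np₂ z₂) :
    IsPathSystemOn ϱ a b w S (idealSpliceN wd hi np₁ np₂) (idealSpliceZ wd hi z₁ z₂) := by
  intro x hx hS
  by_cases hP : n9W wd (toBase wd.length x) ≤ hi
  · have hn : idealSpliceN wd hi np₁ np₂ x = np₁ x := if_pos hP
    have hz : idealSpliceZ wd hi z₁ z₂ x = z₁ x := if_pos hP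
    unfold piece; rw [hn, hz]; exact h₁ x hx hP
  · have hn : idealSpliceN wd hi np₁ np₂ x = np₂ x := if_neg hP
    have hz : idealSpliceZ wd hi z₁ z₂ x = z₂ x := if_neg hP
    unfold piece; rw [hn, hz]; exact h₂ x hx ⟨hP, hS⟩

/-- ★ NEAR ∪ MIDDLE domination: tables on `IdealNear wd hi` (system `np₁, z₁`) and on `¬ IdealNear wd hi ∧ S` (system `np₂, z₂`)
give domination of the ideal splice on `S` with the summed tables. [g100] -/
theorem schemeDominatedOnP_idealCover {ϱ α : ℝ} {a b : E3} {w : ℤ → E3} {wd : List ℤ} {hi : ℤ}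
    {S : (Cell 2 × ℤ) × (Cell 2 × ℤ) → Prop} {np₁ np₂ : (Cell 2 × ℤ) × (Cell 2 × ℤ) → ℕ}
    {z₁ z₂ : (Cell 2 × ℤ) × (Cell 2 × ℤ) → ℕ → Cell 2 × ℤ} {ΘR₁ ΘN₁ ΘR₂ ΘN₂ : (Cell 2 × ℤ) × (Cell 2 × ℤ) → ℝ}
    (h₁ : SchemeDominatedOnP ϱ α a b w np₁ z₁ (IdealNear wd hi) ΘR₁ ΘN₁)
    (h₂ : SchemeDominatedOnP ϱ α a b w np₂ z₂ (fun x => ¬ IdealNear wd hi x ∧ S x) ΘR₂ ΘN₂) :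
    SchemeDominatedOnP ϱ α a b w (idealSpliceN wd hi np₁ np₂) (idealSpliceZ wd hi z₁ z₂) S
      (fun y => ΘR₁ y + ΘR₂ y) (fun y => ΘN₁ y + ΘN₂ y) := by
  intro X hX y
  set X₁ := X.filter (fun x => n9W wd (toBase wd.length x) ≤ hi) with hX₁
  set X₂ := X.filter (fun x => ¬ n9W wd (toBase wd.length x) ≤ hi) with hX₂
  have hA₁ : ∀ x ∈ X₁, ϱ < ‖bondVec a b w x‖ ∧ IdealNear wd hi x := fun x hx => by
    rw [hX₁, Finset.mem_filter] at hx; exact ⟨(hX x hx.1).1, hx.2⟩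
  have hA₂ : ∀ x ∈ X₂, ϱ < ‖bondVec a b w x‖ ∧ (¬ IdealNear wd hi x ∧ S x) := fun x hx => by
    rw [hX₂, Finset.mem_filter] at hx; exact ⟨(hX x hx.1).1, hx.2, (hX x hx.1).2⟩
  have e₁ : ∀ x ∈ X₁, _ := fun x hx =>
    schemeSums_congr (α := α) (a := a) (b := b) (w := w) (show idealSpliceN wd hi np₁ np₂ x = np₁ x from if_pos (hA₁ x hx).2)
      (show idealSpliceZ wd hi z₁ z₂ x = z₁ x from if_pos (hA₁ x hx).2) y
  have e₂ : ∀ x ∈ X₂, _ := fun x hx =>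
    schemeSums_congr (α := α) (a := a) (b := b) (w := w) (show idealSpliceN wd hi np₁ np₂ x = np₂ x from if_neg (hA₂ x hx).2.1)
      (show idealSpliceZ wd hi z₁ z₂ x = z₂ x from if_neg (hA₂ x hx).2.1) y
  obtain ⟨hR₁, hN₁⟩ := h₁ X₁ hA₁ y
  obtain ⟨hR₂, hN₂⟩ := h₂ X₂ hA₂ y
  constructor
  · rw [← Finset.sum_filter_add_sum_filter_not X (fun x => n9W wd (toBase wd.length x) ≤ hi),
      Finset.sum_congr rfl fun x hx => (e₁ x hx).1, Finset.sum_congr rfl fun x hx => (e₂ x hx).1]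
    exact add_le_add hR₁ hR₂
  · rw [← Finset.sum_filter_add_sum_filter_not X (fun x => n9W wd (toBase wd.length x) ≤ hi),
      Finset.sum_congr rfl fun x hx => (e₁ x hx).2, Finset.sum_congr rfl fun x hx => (e₂ x hx).2]
    exact add_le_add hN₁ hN₂

/-! ### §4 the three-way box reader -/

/-- ★★★ **THE THREE-WAY BOX READER**: on a box `B` of the atlas with ideal word `wd` and near cut `hi`, the NEAR reader (data paths and
tables `Θ¹` on `IdealNear wd hi` per admissible word), the MIDDLE king-table domination (`Θ²` on `¬ IdealNear wd hi ∧ ‖e‖ ≤ D`), the box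
fact `‖gen₁ L‖ + ‖gen₂ L‖ + ℓ₀ ≤ ϱ` and the ONE closed numeric FAR-FAR inequality give `BoxSchemeP` for the twice-spliced system with tables
`Θ¹ + Θ² + (1+α)θ`, `Θ¹ + Θ² + (1+α⁻¹)θ`. [g100] -/
theorem boxSchemeP_of_cover3 {s Λ c₀ ℓ₀ ϱ α D θ : ℝ} (hα : 0 < α) (hc : 0 < c₀) (hϱ0 : 0 < ϱ) (hD : 0 < D) {nD n₁ : ℕ}
    (hnD : (nD : ℝ) - 1 ≤ D / ϱ) (h2 : 2 ≤ n₁) (hnD₁ : nD ≤ n₁)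
    (hθ : ∑ n ∈ Finset.Ico nD n₁, (2 * (n : ℝ) * (n + 1) * (2 * n + 1) / 3) * (7 * (n : ℝ) / D ^ 8) +
        14 * ((n₁ : ℝ) + 1) * (2 * n₁ + 1) / (9 * c₀ ^ 8 * (n₁ : ℝ) ^ 2 * ((n₁ : ℝ) - 1) ^ 3) ≤ θ)
    (wd : List ℤ) (hi : ℤ) {B : (E3 ≃L[ℝ] E3) → (ℤ → E3) → Prop}
    {np₁ : (E3 ≃L[ℝ] E3) → (ℤ → E3) → (Cell 2 × ℤ) × (Cell 2 × ℤ) → ℕ}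
    {z₁ : (E3 ≃L[ℝ] E3) → (ℤ → E3) → (Cell 2 × ℤ) × (Cell 2 × ℤ) → ℕ → Cell 2 × ℤ}
    {ΘR₁ ΘN₁ ΘR₂ ΘN₂ : (E3 ≃L[ℝ] E3) → (ℤ → E3) → (Cell 2 × ℤ) × (Cell 2 × ℤ) → ℝ}
    (hgen : ∀ (L : E3 ≃L[ℝ] E3) (w' : ℤ → E3), B L w' → ‖gen₁ L‖ + ‖gen₂ L‖ + ℓ₀ ≤ ϱ)
    (hnear : ∀ a : ℝ, 0 < a → ∀ (L : E3 ≃L[ℝ] E3) (w' : ℤ → E3), IsAdmissibleWord a s Λ c₀ ℓ₀ L w' → B L w' →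
      IsPathSystemOn ϱ (gen₁ L) (gen₂ L) w' (IdealNear wd hi) (np₁ L w') (z₁ L w') ∧
        SchemeDominatedOnP ϱ α (gen₁ L) (gen₂ L) w' (np₁ L w') (z₁ L w') (IdealNear wd hi) (ΘR₁ L w') (ΘN₁ L w'))
    (hmid : ∀ a : ℝ, 0 < a → ∀ (L : E3 ≃L[ℝ] E3) (w' : ℤ → E3), IsAdmissibleWord a s Λ c₀ ℓ₀ L w' → B L w' →
      SchemeDominatedOnP ϱ α (gen₁ L) (gen₂ L) w' kingN kingZ
        (fun x => ¬ IdealNear wd hi x ∧ ‖bondVec (gen₁ L) (gen₂ L) w' x‖ ≤ D) (ΘR₂ L w') (ΘN₂ L w')) :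
    BoxSchemeP s Λ c₀ ℓ₀ ϱ α B
      (fun L w' => pathSpliceN D (gen₁ L) (gen₂ L) w' (idealSpliceN wd hi (np₁ L w') kingN) kingN)
      (fun L w' => pathSpliceZ D (gen₁ L) (gen₂ L) w' (idealSpliceZ wd hi (z₁ L w') kingZ) kingZ)
      (fun L w' y => ΘR₁ L w' y + ΘR₂ L w' y + (1 + α) * θ) (fun L w' y => ΘN₁ L w' y + ΘN₂ L w' y + (1 + α⁻¹) * θ) := by
  refine boxSchemeP_of_split hα hc hϱ0 hD hnD h2 hnD₁ hθ hgen fun a ha L w' hA hB => ?_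
  obtain ⟨hP₁, hS₁⟩ := hnear a ha L w' hA hB
  have hw : IsLayeredCrystal c₀ (gen₁ L) (gen₂ L) w' := hA.2.2.2.1
  have hlip : ∀ m : ℤ, ‖w' (m + 1) - w' m‖ ≤ ℓ₀ := hA.2.2.2.2.1
  have hK := isPathSystemOn_of (isPathSystem_king hc hw hlip (hgen L w' hB))
    (fun x => ¬ IdealNear wd hi x ∧ ‖bondVec (gen₁ L) (gen₂ L) w' x‖ ≤ D)
  exact ⟨isPathSystemOn_idealCover hP₁ hK, schemeDominatedOnP_idealCover hS₁ (hmid a ha L w' hA hB)⟩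

end Summit.AtomisticToContinuum.Crystallization.Theorems.ChartedZeroExcessLayeredLatticeLiouville
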